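/-
Copyright (c) 2026 the pub-hodgecm-mathlib formalisation cell (harness21).  Prover seat hodgecm-mathlib-K2E4-p07 (g2),
Track B «K2-LIT» ∕ h413, unit «FinGermConstants» of the line `K2_E4_SingularTransferKappaSign`, socket #7R
`K2E4SingularTransferKappaSign.FinGermConstants.sig_K2E3GermConstantRegularHR` (ED. 4), STEP (iii) of its non-split residue: THE ε-ONLY CENTRAL SINGULAR JUNCTION —
`φ^H := Δ₀ • φ_ε` is a local `Δ‴_v`-transfer of a test function invisible to the `ε′`-side, with its value in hand.  2026-09-03.
-/
import Literature.NumberTheory.Rogawski1990.LocalTransferCentralSingularJunctionInvCM       -- ★ p841647: the (R-inv) junction replayed here without its `hI′`; ★ `finsum_mem_side_eq_mul_stableOrbitalIntegralRel`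
import HarnessLib

/-!
# K2_E4 road (h413 = stmt-HodgeConjecture-24833), socket #7R `sig_K2E3GermConstantRegularHR`, non-split residue STEP (iii):
# the ε-ONLY central singular junction — for `φ` invisible to the `ε′`-side classes, `Φ^st_H(γ_H, Δ₀ • φ_ε) = Σ_c Δ‴_v(γ_H, c) Φ(c, φ)` near `ε_H`, `Δ₀ = Δ‴_v(ε_H, ε)`

Cell `pub/hodgecm-mathlib` (D-0151), Track B; socket **`sig_K2E3GermConstantRegularHR`** (FinGermConstants ED. 3∕4 :309, R-twin of #7; OWNER K2E3, base K2E4-p07).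
★ `LocalTransferCentralSingularJunctionInvCM.exists_nhds_stableOrbitalIntegralRel_eq_of_central_singular_inv` (p841647) builds the local transfer near the central
`(G,H)`-regular point `ε_H = (a·1₂, u)` as `φ^H := Δ₀ • φ_ε + ψ′`, where `ψ′` carries the `ε′`-side (binder `hI′`, paid over the rank-one Euler–Poincaré letter) and `φ_ε` is
the Harish-Chandra descent of `φ` at `ε` (binder `hD`, an opaque `∃`).  For #7R we need the VALUE `φ^H(ε_H)`, so THIS FILE replays p841647's proof with two changes: the
descent datum `(B, φ_ε)` is a BINDER IN HAND (supplied with its value by ★ `K2E3GermConstantRegularHRDescentWitness`), and `hI′` is replaced by «the `Q′`-side classes near `ε_H`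
do not see `φ`» (`Δ‴_v(γ_H, c)·Φ(c, φ) = 0` there — supplied by ★ `K2E3GermConstantRegularHRDockSideOnly` for `φ` supported near `ε`), so that the `ε′`-side of
`R_φ(γ_H) = Σ_c Δ‴_v(γ_H, c)·Φ(c, φ)` VANISHES and `φ^H := Δ₀ • φ_ε` alone satisfies (4.3.1) near `ε_H` — with `φ^H(ε_H) = Δ₀·φ_ε(ε_H)` visible to the caller.
The ε-side bookkeeping is ★ `finsum_mem_side_eq_mul_stableOrbitalIntegralRel` BY NAME, as in p841647.  [Rogawski1990 §8.2 Prop. 8.2.1 (a)(d) ⟸ Prop. 8.1.3;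
LanglandsShelstad1990Descent Thm. 2.3.A, §2.4.]

* **`exists_nhds_stableOrbitalIntegralRel_smul_eq_of_dockSide`** — p841647's binders (minus `νH`, `hmH`, `hD`, `hI′`; plus the descent witness `(φ, B, φε, hdesc)` and `hQ0`);
  conclusion `∃ V ∈ 𝓝 ε_H, ∀ γ_H ∈ V` `G`-regular, `Φ^st_H(γ_H, Δ‴_v(ε_H, ε) • φ_ε) = Σᶠ_c Δ‴_v(γ_H, c)·Φ(c, φ)`.

HONEST LABEL: HC_CM is proved only modulo the 7 printed citations (2 remaining named inputs: hLiu418 = stmt-HodgeConjecture-24832, h413 =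
stmt-HodgeConjecture-24833) until rung 0 closes; this file is a `--supports stmt-HodgeConjecture-24833` helper (step (iii) of 4 of #7R's non-split residue) and retires
nothing by itself.
-/

set_option autoImplicit false
set_option linter.dupNamespace false

noncomputable section

open Set Filter Topology MeasureTheory Polynomial
open scoped Pointwise Matrix

namespace Summit.HodgeConjecture.HodgeConjecture.Cruxes.H413.K2E3GermConstantRegularHRLocalPair

open Literature.NumberTheory.Rogawski1990
open Literature.NumberTheory.Automorphic Literature.NumberTheory.Automorphic.UnitaryGroup Literature.NumberTheory.GaloisRepresentations
open _root_.NumberField _root_.IsDedekindDomain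

section EpsilonOnly

variable (L : Type) [Field L] [NumberField L] [IsCMField L] (H' : Matrix (Fin 3) (Fin 3) L) (v : HeightOneSpectrum (𝓞 ↥(maximalRealSubfield L)))

variable [iM' : ∀ γ : (cmDatum L 3 H').Local v, MeasurableSpace ((cmDatum L 3 H').Local v ⧸ Subgroup.centralizer ({γ} : Set ((cmDatum L 3 H').Local v)))]
  [iH : ∀ a : ((cmDatum L 2 (Matrix.of fun i j : Fin 2 => if i.val + j.val + 1 = 2 then (1 : L) else 0)).Local v ×
      (cmDatum L 1 (Matrix.of fun i j : Fin 1 => if i.val + j.val + 1 = 1 then (1 : L) else 0)).Local v), MeasurableSpace (((cmDatum L 2 (Matrix.of fun i j : Fin 2 => if i.val + j.val + 1 = 2 then (1 : L) else 0)).Local v ×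
      (cmDatum L 1 (Matrix.of fun i j : Fin 1 => if i.val + j.val + 1 = 1 then (1 : L) else 0)).Local v) ⧸ Subgroup.centralizer ({a} : Set ((cmDatum L 2 (Matrix.of fun i j : Fin 2 => if i.val + j.val + 1 = 2 then (1 : L) else 0)).Local v ×
      (cmDatum L 1 (Matrix.of fun i j : Fin 1 => if i.val + j.val + 1 = 1 then (1 : L) else 0)).Local v)))]

/-- **THE ε-ONLY CENTRAL SINGULAR JUNCTION.**  Data (`v` non-split, explicit `Δ_v = (finExplicitCollection μ) v`): the central dock `θ : H_v ≃ₜ* Z_{G′_v}(ε)`, `θ z = y·ι(z)·y⁻¹`;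
an abstract `ε′`-side predicate `Q′`; `hsep′`, `hside`, `hdisj`, `hΔθ` exactly as in ★ p841647; a test function `φ ∈ C_c^∞(G′_v)` WITH ITS DESCENT WITNESS `(B, φ_ε)` at `ε`
(`Φ(⟦θ h⟧, φ) = Φ(⟦h⟧, φ_ε)` for `G`-regular `h` in the stably saturated `B ∈ 𝓝 ε_H`); and `hQ0`: near `ε_H` the `Q′`-side classes carry `Δ‴_v(γ_H, c)·Φ(c, φ) = 0`.
CONCLUSION: on some `V ∈ 𝓝 ε_H`, `Φ^st_H(γ_H, Δ₀ • φ_ε) = Σᶠ_c Δ‴_v(γ_H, c)·Φ(c, φ)` for `G`-regular `γ_H`, `Δ₀ := Δ‴_v(ε_H, ε)` — (4.3.1) for the pair `(Δ₀ • φ_ε, φ)` near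
`ε_H`.  Proof = p841647's: split `R_φ = 1_ε R_φ + 1_{ε′} R_φ` by `hside`∕`hdisj`; the `ε′`-part is `0` by `hQ0`; the `ε`-part is `Δ₀·Φ^st_H(γ_H, φ_ε)` by ★
`finsum_mem_side_eq_mul_stableOrbitalIntegralRel` (descent + `hsep′` + `hΔθ`, saturation trivial on the stably saturated box `B ∩ B₇`); `Φ^st(·, Δ₀ • φ_ε) = Δ₀ Φ^st(·, φ_ε)`.
[cite: Rogawski1990, §8.2 Prop. 8.2.1 (a)(d) pp. 112, 118–122; §8.1 Prop. 8.1.3 pp. 110–111; §4.3 (4.3.1) p. 43] [cite: LanglandsShelstad1990Descent, Thm. 2.3.A, §2.4] -/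
theorem exists_nhds_stableOrbitalIntegralRel_smul_eq_of_dockSide
    (hH' : (H'.map (cmConjRingHom L))ᵀ = H') (hdet' : H'.det ≠ 0) (μ : HeckeCharacter L)
    (hl : ∀ (v : HeightOneSpectrum (𝓞 ↥(maximalRealSubfield L))) (a : ((cmDatum L 2 (Matrix.of fun i j : Fin 2 => if i.val + j.val + 1 = 2 then (1 : L) else 0)).Local v ×
      (cmDatum L 1 (Matrix.of fun i j : Fin 1 => if i.val + j.val + 1 = 1 then (1 : L) else 0)).Local v)) (b : (cmDatum L 3 H').Local v) (x : ((cmDatum L 2 (Matrix.of fun i j : Fin 2 => if i.val + j.val + 1 = 2 then (1 : L) else 0)).Local v ×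
      (cmDatum L 1 (Matrix.of fun i j : Fin 1 => if i.val + j.val + 1 = 1 then (1 : L) else 0)).Local v)),
      finExplicitDelta L v H' (x * a * x⁻¹) μ b = finExplicitDelta L v H' a μ b)
    (hr : ∀ (v : HeightOneSpectrum (𝓞 ↥(maximalRealSubfield L))) (a : ((cmDatum L 2 (Matrix.of fun i j : Fin 2 => if i.val + j.val + 1 = 2 then (1 : L) else 0)).Local v ×
      (cmDatum L 1 (Matrix.of fun i j : Fin 1 => if i.val + j.val + 1 = 1 then (1 : L) else 0)).Local v)) (b y : (cmDatum L 3 H').Local v),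
      finExplicitDelta L v H' a μ (y * b * y⁻¹) = finExplicitDelta L v H' a μ b)
    {mH : OrbitalMeasureFamily ((cmDatum L 2 (Matrix.of fun i j : Fin 2 => if i.val + j.val + 1 = 2 then (1 : L) else 0)).Local v ×
      (cmDatum L 1 (Matrix.of fun i j : Fin 1 => if i.val + j.val + 1 = 1 then (1 : L) else 0)).Local v)} {mG : OrbitalMeasureFamily ((cmDatum L 3 H').Local v)}
    -- the central point and the dock at the good class `ε`
    (εH : ((cmDatum L 2 (Matrix.of fun i j : Fin 2 => if i.val + j.val + 1 = 2 then (1 : L) else 0)).Local v ×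
      (cmDatum L 1 (Matrix.of fun i j : Fin 1 => if i.val + j.val + 1 = 1 then (1 : L) else 0)).Local v)) (ε : (cmDatum L 3 H').Local v) (y : GL (Fin 3) (LocalRing L v))
    (θ : ((cmDatum L 2 (Matrix.of fun i j : Fin 2 => if i.val + j.val + 1 = 2 then (1 : L) else 0)).Local v ×
      (cmDatum L 1 (Matrix.of fun i j : Fin 1 => if i.val + j.val + 1 = 1 then (1 : L) else 0)).Local v) ≃ₜ* ↥(Subgroup.centralizer ({ε} : Set ((cmDatum L 3 H').Local v))))
    (hθ : ∀ z : ((cmDatum L 2 (Matrix.of fun i j : Fin 2 => if i.val + j.val + 1 = 2 then (1 : L) else 0)).Local v ×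
      (cmDatum L 1 (Matrix.of fun i j : Fin 1 => if i.val + j.val + 1 = 1 then (1 : L) else 0)).Local v), (((θ z).1).val : GL (Fin 3) (LocalRing L v)) = y * ((endoEmbLocal L v z).val : GL (Fin 3) (LocalRing L v)) * y⁻¹)
    -- the `ε′`-side predicate (abstract; in the application: «unitarily conjugate into the frame of `ε′` with second block `γ₂`»)
    (Q' : ((cmDatum L 2 (Matrix.of fun i j : Fin 2 => if i.val + j.val + 1 = 2 then (1 : L) else 0)).Local v ×
      (cmDatum L 1 (Matrix.of fun i j : Fin 1 => if i.val + j.val + 1 = 1 then (1 : L) else 0)).Local v) → (cmDatum L 3 H').Local v → Prop)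
    -- (SEP′) on a stably saturated neighbourhood
    (hsep' : ∃ B₇ ∈ 𝓝 εH, (∀ h ∈ B₇, ∀ h' : ((cmDatum L 2 (Matrix.of fun i j : Fin 2 => if i.val + j.val + 1 = 2 then (1 : L) else 0)).Local v ×
      (cmDatum L 1 (Matrix.of fun i j : Fin 1 => if i.val + j.val + 1 = 1 then (1 : L) else 0)).Local v), IsLocalStablyConjH L v h h' → h' ∈ B₇) ∧
      ∀ h ∈ B₇, ∀ h' ∈ B₇, ∀ x : (cmDatum L 3 H').Local v, x * ((θ h : ↥(Subgroup.centralizer ({ε} : Set ((cmDatum L 3 H').Local v)))) : (cmDatum L 3 H').Local v) * x⁻¹ = ((θ h' : ↥(Subgroup.centralizer ({ε} : Set ((cmDatum L 3 H').Local v)))) : (cmDatum L 3 H').Local v) → IsConj h h')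
    -- the side dichotomy near `ε_H` and its exclusivity
    (hside : ∃ V₃ ∈ 𝓝 εH, ∀ γH ∈ V₃, IsLocalGRegular L v γH → ∀ γ' : (cmDatum L 3 H').Local v, IsLocalNormPair L H' v γH γ' →
      (∃ x : (cmDatum L 3 H').Local v, ∃ h : ((cmDatum L 2 (Matrix.of fun i j : Fin 2 => if i.val + j.val + 1 = 2 then (1 : L) else 0)).Local v ×
      (cmDatum L 1 (Matrix.of fun i j : Fin 1 => if i.val + j.val + 1 = 1 then (1 : L) else 0)).Local v), IsLocalStablyConjH L v γH h ∧ x * γ' * x⁻¹ = ((θ h : ↥(Subgroup.centralizer ({ε} : Set ((cmDatum L 3 H').Local v)))) : (cmDatum L 3 H').Local v)) ∨ (∃ x : (cmDatum L 3 H').Local v, Q' γH (x * γ' * x⁻¹)))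
    (hdisj : ∃ V₀ ∈ 𝓝 εH, ∀ γH ∈ V₀, IsLocalGRegular L v γH → ∀ γ' : (cmDatum L 3 H').Local v,
      (∃ x : (cmDatum L 3 H').Local v, ∃ h : ((cmDatum L 2 (Matrix.of fun i j : Fin 2 => if i.val + j.val + 1 = 2 then (1 : L) else 0)).Local v ×
      (cmDatum L 1 (Matrix.of fun i j : Fin 1 => if i.val + j.val + 1 = 1 then (1 : L) else 0)).Local v), IsLocalStablyConjH L v γH h ∧ x * γ' * x⁻¹ = ((θ h : ↥(Subgroup.centralizer ({ε} : Set ((cmDatum L 3 H').Local v)))) : (cmDatum L 3 H').Local v)) → (∃ x : (cmDatum L 3 H').Local v, Q' γH (x * γ' * x⁻¹)) → False)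
    -- the test function and its DESCENT WITNESS at `ε` on a stably saturated neighbourhood, read on `H_v` through `θ` (★ K2E3GermConstantRegularHRDescentWitness)
    (φ : (cmDatum L 3 H').Local v → ℂ) (hφ : IsLocSmooth φ)
    {B : Set ((cmDatum L 2 (Matrix.of fun i j : Fin 2 => if i.val + j.val + 1 = 2 then (1 : L) else 0)).Local v ×
      (cmDatum L 1 (Matrix.of fun i j : Fin 1 => if i.val + j.val + 1 = 1 then (1 : L) else 0)).Local v)} (hB : B ∈ 𝓝 εH)
    (hBsat : ∀ h ∈ B, ∀ h' : ((cmDatum L 2 (Matrix.of fun i j : Fin 2 => if i.val + j.val + 1 = 2 then (1 : L) else 0)).Local v ×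
      (cmDatum L 1 (Matrix.of fun i j : Fin 1 => if i.val + j.val + 1 = 1 then (1 : L) else 0)).Local v), IsLocalStablyConjH L v h h' → h' ∈ B)
    (φε : ((cmDatum L 2 (Matrix.of fun i j : Fin 2 => if i.val + j.val + 1 = 2 then (1 : L) else 0)).Local v ×
      (cmDatum L 1 (Matrix.of fun i j : Fin 1 => if i.val + j.val + 1 = 1 then (1 : L) else 0)).Local v) → ℂ)
    (hdesc : ∀ h ∈ B, IsLocalGRegular L v h → classOrbitalIntegral mG φ (ConjClasses.mk ((θ h : ↥(Subgroup.centralizer ({ε} : Set ((cmDatum L 3 H').Local v)))) : (cmDatum L 3 H').Local v)) = classOrbitalIntegral mH φε (ConjClasses.mk h))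
    -- `Δ_v` along the dock on stable classes near `ε_H`
    (hΔθ : ∃ VΔ ∈ 𝓝 εH, ∀ γH ∈ VΔ, IsLocalGRegular L v γH → ∀ h : ((cmDatum L 2 (Matrix.of fun i j : Fin 2 => if i.val + j.val + 1 = 2 then (1 : L) else 0)).Local v ×
      (cmDatum L 1 (Matrix.of fun i j : Fin 1 => if i.val + j.val + 1 = 1 then (1 : L) else 0)).Local v), IsLocalStablyConjH L v γH h →
      finExplicitDelta L v H' γH μ ((θ h : ↥(Subgroup.centralizer ({ε} : Set ((cmDatum L 3 H').Local v)))) : (cmDatum L 3 H').Local v) = finExplicitDelta L v H' εH μ ε)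
    -- the `Q′`-side classes near `ε_H` do not see `φ` (★ K2E3GermConstantRegularHRDockSideOnly)
    (hQ0 : ∃ V₆ ∈ 𝓝 εH, ∀ γH ∈ V₆, IsLocalGRegular L v γH → ∀ c : ConjClasses ((cmDatum L 3 H').Local v), (∃ x : (cmDatum L 3 H').Local v, Q' γH (x * Quotient.out c * x⁻¹)) →
      ((finExplicitCollection L H' μ hl hr) v).Δ γH (Quotient.out c) * classOrbitalIntegral mG φ c = 0) :
    ∃ V ∈ 𝓝 εH, ∀ γH ∈ V, IsLocalGRegular L v γH →
      stableOrbitalIntegralRel (IsLocalStablyConjH L v) mH (finExplicitDelta L v H' εH μ ε • φε) γH =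
        ∑ᶠ c : ConjClasses ((cmDatum L 3 H').Local v), ((finExplicitCollection L H' μ hl hr) v).Δ γH (Quotient.out c) * classOrbitalIntegral mG φ c := by
  classical
  have hΔT : ∀ (a' : ((cmDatum L 2 (Matrix.of fun i j : Fin 2 => if i.val + j.val + 1 = 2 then (1 : L) else 0)).Local v ×
      (cmDatum L 1 (Matrix.of fun i j : Fin 1 => if i.val + j.val + 1 = 1 then (1 : L) else 0)).Local v)) (b : (cmDatum L 3 H').Local v), ((finExplicitCollection L H' μ hl hr) v).Δ a' b = finExplicitDelta L v H' a' μ b :=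
    fun a' b => finExplicitCollection_Δ L H' μ hl hr v a' b
  -- matching along the dock
  have hθm : ∀ h : ((cmDatum L 2 (Matrix.of fun i j : Fin 2 => if i.val + j.val + 1 = 2 then (1 : L) else 0)).Local v ×
      (cmDatum L 1 (Matrix.of fun i j : Fin 1 => if i.val + j.val + 1 = 1 then (1 : L) else 0)).Local v), IsLocalNormPair L H' v h ((θ h : ↥(Subgroup.centralizer ({ε} : Set ((cmDatum L 3 H').Local v)))) : (cmDatum L 3 H').Local v) := fun h => isConj_iff.2 ⟨y, (hθ h).symm⟩
  -- descent, separation, exclusivity, sides, `Δ`, the `ε′`-side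
  obtain ⟨B₇, hB₇, hB₇sat, hsep⟩ := hsep'
  obtain ⟨V₃, hV₃, hsd⟩ := hside
  obtain ⟨V₀, hV₀, hdj⟩ := hdisj
  obtain ⟨VΔ, hVΔ, hΔ⟩ := hΔθ
  obtain ⟨V₆, hV₆, hI⟩ := hQ0
  -- the stably saturated «box» `B := B₄ ∩ B₇`
  set B' : Set ((cmDatum L 2 (Matrix.of fun i j : Fin 2 => if i.val + j.val + 1 = 2 then (1 : L) else 0)).Local v ×
      (cmDatum L 1 (Matrix.of fun i j : Fin 1 => if i.val + j.val + 1 = 1 then (1 : L) else 0)).Local v) := B ∩ B₇ with hB'def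
  have hB' : B' ∈ 𝓝 εH := inter_mem hB hB₇
  have hB'sat : ∀ h ∈ B', ∀ h' : ((cmDatum L 2 (Matrix.of fun i j : Fin 2 => if i.val + j.val + 1 = 2 then (1 : L) else 0)).Local v ×
      (cmDatum L 1 (Matrix.of fun i j : Fin 1 => if i.val + j.val + 1 = 1 then (1 : L) else 0)).Local v), IsLocalStablyConjH L v h h' → h' ∈ B' :=
    fun h hh h' hst => ⟨hBsat h hh.1 h' hst, hB₇sat h hh.2 h' hst⟩
  -- the neighbourhood
  set Δ₀ : ℂ := finExplicitDelta L v H' εH μ ε with hΔ₀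
  refine ⟨V₃ ∩ V₀ ∩ VΔ ∩ V₆ ∩ B', inter_mem (inter_mem (inter_mem (inter_mem hV₃ hV₀) hVΔ) hV₆) hB', ?_⟩
  rintro γH ⟨⟨⟨⟨hγ₃, hγ₀⟩, hγΔ⟩, hγ₆⟩, hγB⟩ hγreg
  -- the summand and the two side predicates
  set F : ConjClasses ((cmDatum L 3 H').Local v) → ℂ := fun c =>
    ((finExplicitCollection L H' μ hl hr) v).Δ γH (Quotient.out c) * classOrbitalIntegral mG φ c with hFdef
  set Pε : ConjClasses ((cmDatum L 3 H').Local v) → Prop := fun c =>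
    ∃ x : (cmDatum L 3 H').Local v, ∃ h ∈ B', IsLocalStablyConjH L v γH h ∧ x * Quotient.out c * x⁻¹ = ((θ h : ↥(Subgroup.centralizer ({ε} : Set ((cmDatum L 3 H').Local v)))) : (cmDatum L 3 H').Local v) with hPεdef
  set Pε' : ConjClasses ((cmDatum L 3 H').Local v) → Prop := fun c => ∃ x : (cmDatum L 3 H').Local v, Q' γH (x * Quotient.out c * x⁻¹) with hPε'def
  have hFfin : (Function.support F).Finite :=
    finite_support_delta_mul_classOrbitalIntegral_of_isLocSmooth L H' v hH' hdet' _ mG φ hφ γH hγreg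
  -- (1) split `F = 1_ε F + 1_{ε′} F` (the side dichotomy + exclusivity; unmatched classes carry `Δ = 0`)
  have hsplit : ∀ c, F c = (if Pε c then F c else 0) + (if Pε' c then F c else 0) := by
    intro c
    by_cases hR : IsLocalNormPair L H' v γH (Quotient.out c)
    · rcases hsd γH hγ₃ hγreg _ hR with ⟨x, h, hst, hx⟩ | ⟨x, hx⟩
      · have hP : Pε c := ⟨x, h, hB'sat γH hγB h hst, hst, hx⟩
        have hnP : ¬ Pε' c := fun h' => hdj γH hγ₀ hγreg _ ⟨x, h, hst, hx⟩ h'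
        rw [if_pos hP, if_neg hnP, add_zero]
      · have hP : Pε' c := ⟨x, hx⟩
        have hnP : ¬ Pε c := fun ⟨x', h, _, hst, hx'⟩ => hdj γH hγ₀ hγreg _ ⟨x', h, hst, hx'⟩ ⟨x, hx⟩
        rw [if_neg hnP, if_pos hP, zero_add]
    · have hF0 : F c = 0 := by
        simp only [hFdef, hΔT, finExplicitDelta_of_not_isLocalNormPair L v H' γH μ hR, zero_mul]
      simp only [hF0, ite_self, add_zero]
  have hfin₁ : (Function.support fun c => if Pε c then F c else 0).Finite :=
    hFfin.subset fun c hc => by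
      simp only [Function.mem_support, ne_eq, ite_eq_right_iff, Classical.not_imp] at hc ⊢
      exact hc.2
  have hfin₂ : (Function.support fun c => if Pε' c then F c else 0).Finite :=
    hFfin.subset fun c hc => by
      simp only [Function.mem_support, ne_eq, ite_eq_right_iff, Classical.not_imp] at hc ⊢
      exact hc.2
  have hsum : (∑ᶠ c, F c) = (∑ᶠ c, if Pε c then F c else 0) + ∑ᶠ c, if Pε' c then F c else 0 := by
    rw [← finsum_add_distrib hfin₁ hfin₂]
    exact finsum_congr hsplit
  have hite : ∀ P : ConjClasses ((cmDatum L 3 H').Local v) → Prop, (∑ᶠ c, if P c then F c else 0) = ∑ᶠ c ∈ {c | P c}, F c := by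
    intro P
    rw [finsum_mem_def]
    exact finsum_congr fun c => (Set.indicator_apply _ _ _).symm
  -- (2) the `ε′`-side VANISHES: its classes do not see `φ`
  have hε'side : (∑ᶠ c, if Pε' c then F c else 0) = 0 := by
    refine finsum_eq_zero_of_forall_eq_zero fun c => ?_
    by_cases hc : Pε' c
    · rw [if_pos hc]; exact hI γH hγ₆ hγreg c hc
    · rw [if_neg hc]
  -- (3) the ε-side is `Δ₀ · Φ^st(γ_H, φ_ε)` (★ bookkeeping lemma of the box junction; saturation into `B` is the identity conjugator)
  have hregB : ∀ h, IsLocalStablyConjH L v γH h → IsLocalGRegular L v h := fun h hst => isGRegular_of_isStablyConjH _ _ _ _ hst hγreg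
  have hsatB : ∀ γH' : ((cmDatum L 2 (Matrix.of fun i j : Fin 2 => if i.val + j.val + 1 = 2 then (1 : L) else 0)).Local v ×
      (cmDatum L 1 (Matrix.of fun i j : Fin 1 => if i.val + j.val + 1 = 1 then (1 : L) else 0)).Local v), IsLocalStablyConjH L v γH γH' → ∃ x : ((cmDatum L 2 (Matrix.of fun i j : Fin 2 => if i.val + j.val + 1 = 2 then (1 : L) else 0)).Local v ×
      (cmDatum L 1 (Matrix.of fun i j : Fin 1 => if i.val + j.val + 1 = 1 then (1 : L) else 0)).Local v), x * γH' * x⁻¹ ∈ B' :=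
    fun γH' hst => ⟨1, by rw [one_mul, inv_one, mul_one]; exact hB'sat γH hγB γH' hst⟩
  have hΔB : ∀ h ∈ B', IsLocalStablyConjH L v γH h → finExplicitDelta L v H' γH μ ((θ h : ↥(Subgroup.centralizer ({ε} : Set ((cmDatum L 3 H').Local v)))) : (cmDatum L 3 H').Local v) = Δ₀ :=
    fun h _ hst => hΔ γH hγΔ hγreg h hst
  have hεside : (∑ᶠ c, if Pε c then F c else 0) = Δ₀ * stableOrbitalIntegralRel (IsLocalStablyConjH L v) mH φε γH := by
    rw [hite]
    exact finsum_mem_side_eq_mul_stableOrbitalIntegralRel L H' v μ hl hr mH mG θ γH B' φ φε Δ₀ hsatB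
      (fun h hh h' hh' x hx => hsep h hh.2 h' hh'.2 x hx) hΔB
      (fun h hhB hst => hdesc h hhB.1 (hregB h hst))
  -- (4) assemble: `Φ^st(γ_H, Δ₀ • φ_ε) = Δ₀ Φ^st(γ_H, φ_ε)`
  rw [hsum, hεside, hε'side, add_zero, ← stableOrbitalIntegralRel_smul_fun]

end EpsilonOnly

end Summit.HodgeConjecture.HodgeConjecture.Cruxes.H413.K2E3GermConstantRegularHRLocalPair

end
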